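import Summits.AnomalousDissipation.AnomalousDissipation.Theorems.SawtoothPulseCascadeK1LocalisedCascadeFirstGoodPieceLt

/-!
# K1loc, line `Spectral` — S-D (first good piece): THE REST-SET ENERGY THROUGH MODULATED COLUMNS

Helper file of the prover lane on the crux `K1LocalisedCascade` (stmt-AnomalousDissipation-19491), route
`SawtoothPulseCascade`, registered line `Cruxes.K1LocalisedCascade.Spectral` (one open stub `stub_highModeConcentration`).
Improvement of the `Λ`-part of `…FirstGoodPieceLt.sqrt_lowModes_le_firstGoodPiece_lt` (there: `#R` times the square of the per-mode
bound): the energy of the inviscid iterate on a whole horizontal frequency `m ≠ 0`, `Σ_{k₁} |𝓕(a_n)(m, k₁)|²`, is the column energy of the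
MODULATED iterate `e_{−m e₀} a_n` (`mFourierCoeff_char_mul`, `…AxisBlock.hasSum_axisBlock`), whose line means are the chord sums with
horizontal frequency `m` (`…ColumnBoundLt.chord_sum_le_axisAvg_lt`), hence `≤ ∫ (C_K + axisAvg 0 1_{Bad})² ≤ C_K² + (2C_K + 1)vol(Bad)`.

* `mFourierCoeff_char_mul` — `𝓕(e_{−m}·f)(k) = 𝓕f(k + m)`;
* `restEnergy_le_lt` — `Σ_{k ∈ R} |𝓕(a_n)(k)|² ≤ 2K (C_K² + (2C_K+1) vol(Bad))` for `R ⊆ {0 < |k₀| ≤ K}`, `K < (γ²−3)^n`;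
* `sqrt_lowModes_le_firstGoodPiece_cols` — the first-good-piece lemma with `Λ = 2K(C_K² + (2C_K+1)V_B)`.

[cite: ElgindiLissMattingly2025, §1.2.2, §3.1] [cite: Grafakos2014, Prop. 3.1.2, Prop. 3.2.7 (3)] [problem: turb]
-/

-- `Summit.<Summit>.<Problem>`: single-conjunct summit, the duplicate namespace segment is deliberate.
set_option linter.dupNamespace false

noncomputable section

namespace Summit.AnomalousDissipation.AnomalousDissipation.Theorems.SawtoothPulseCascade.K1Start

open Set Function MeasureTheory UnitAddTorus
open scoped ENNReal
open Literature.Analysis Literature.Analysis.FunctionSpaces Literature.Analysis.FunctionSpaces.Torus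
open Literature.Analysis.FluidPDE.ShearStage
open Literature.Analysis.FluidPDE.SawtoothCascade Literature.Analysis.FluidPDE.SawtoothCascade.CascadeParams

/-! ## §1 Modulation shifts the coefficients -/

/-- **Modulation shifts the Fourier coefficients**: `𝓕(e_{−m} · f)(k) = 𝓕f(k + m)`. [cite: Grafakos2014, Prop. 3.1.2] -/
theorem mFourierCoeff_char_mul {d : Type*} [Fintype d] [DecidableEq d] (f : UnitAddTorus d → ℂ) (m k : d → ℤ) :
    mFourierCoeff (fun x => mFourier (-m) x * f x) k = mFourierCoeff f (k + m) := by
  rw [mFourierCoeff_eq_integral_volume, mFourierCoeff_eq_integral_volume]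
  congr 1
  funext x
  rw [neg_add, mFourier_add, smul_eq_mul, smul_eq_mul, mul_assoc]

/-- `∫ (C + h)² ≤ C² + (2C + 1)∫ h` for `0 ≤ h ≤ 1`, `C ≥ 0` (and `(C + h)²` is integrable). [folklore] -/
theorem integral_const_add_sq_le {h : UnitAddTorus (Fin 2) → ℝ} (hh_meas : AEStronglyMeasurable h volume)
    (hh01 : ∀ x, 0 ≤ h x ∧ h x ≤ 1) {C : ℝ} (hC : 0 ≤ C) :
    Integrable (fun x => (C + h x) ^ 2) volume ∧ ∫ x, (C + h x) ^ 2 ≤ C ^ 2 + (2 * C + 1) * ∫ x, h x := by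
  have hh_i : Integrable h volume :=
    Integrable.of_bound hh_meas 1 (Filter.Eventually.of_forall fun x => by
      rw [Real.norm_eq_abs, abs_le]; exact ⟨by linarith [(hh01 x).1], (hh01 x).2⟩)
  have hg_i : Integrable (fun x => (C + h x) ^ 2) volume := by
    refine Integrable.of_bound ((aestronglyMeasurable_const.add hh_meas).pow 2) ((C + 1) ^ 2)
      (Filter.Eventually.of_forall fun x => ?_)
    rw [Real.norm_eq_abs, abs_of_nonneg (sq_nonneg _)]
    exact pow_le_pow_left₀ (by linarith [(hh01 x).1]) (by linarith [(hh01 x).2]) 2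
  refine ⟨hg_i, ?_⟩
  have hpt : ∀ x, (C + h x) ^ 2 ≤ C ^ 2 + (2 * C + 1) * h x := by
    intro x
    have h1 : h x ^ 2 ≤ h x := by nlinarith [(hh01 x).1, (hh01 x).2]
    nlinarith
  calc ∫ x, (C + h x) ^ 2 ≤ ∫ x, (C ^ 2 + (2 * C + 1) * h x) :=
        integral_mono hg_i ((integrable_const _).add (hh_i.const_mul _)) hpt
    _ = C ^ 2 + (2 * C + 1) * ∫ x, h x := by
        rw [integral_add (integrable_const _) (hh_i.const_mul _), MeasureTheory.integral_const, integral_const_mul,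
          probReal_univ, one_smul]

/-! ## §2 The rest-set energy -/

section Cascade

variable (P : CascadeParams)

/-- **The rest-set energy through modulated columns.**  For a finite set `R` of modes with `0 < |k₀| ≤ K`, `K < (γ²−3)^n`:
`Σ_{k∈R} |𝓕(a_n)(k)|² ≤ 2K · (C_K² + (2C_K + 1)·vol(Bad))`, `C_K = B_n/(π(1 − K(γ²−3)^{−n})) + 2πE_V` (each horizontal frequency `m` is
the column of `e_{−m e₀} a_n`, whose line means are bounded by `C_K + axisAvg 0 1_{Bad}`).
[cite: ElgindiLissMattingly2025, §1.2.2, §3.1] [cite: Grafakos2014, Prop. 3.2.7 (3)] -/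
theorem restEnergy_le_lt (hγ : 1 ≤ P.γ) (h8 : 8 ≤ P.γ ^ 2) (hδ₀ : 0 < P.δ₀) (hd : 0 < P.d) (hN₀ : 1 ≤ P.N₀) (hρ : 1 ≤ P.ρN)
    {M₁ M₂ : ℝ} (hM₁ : 0 < M₁) (hM : 1 ≤ M₂) (hMδ : ∀ j, M₂ * P.δ j < Real.pi / 2) {n : ℕ}
    (a b : ℕ → UnitAddTorus (Fin 2) → ℝ) (has : ∀ j, IsSmooth (a j)) (h0 : a 0 = datum)
    (hb : ∀ j, b j = a j ∘ shearMap 0 1 (amp ⟨P.U j, P.U_periodic j, P.contDiff_U (P.δ_pos hδ₀ hd j)⟩ P.γ))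
    (hab : ∀ j, a (j + 1) = b j ∘ shearMap 1 0 (amp ⟨P.U j, P.U_periodic j, P.contDiff_U (P.δ_pos hδ₀ hd j)⟩ P.γ))
    {EV EH : ℝ} (B : ℕ → ℝ) (hEV0 : 0 ≤ EV)
    (hEV : ∀ ℓ, ℓ ≤ n → (∑ i ∈ Finset.range ℓ, (1 + P.γ + P.γ ^ 2) ^ i *
        ((P.γ ^ 2 * (1 / (2 * P.N (n - ℓ + i)) - M₂ * P.δ (n - ℓ + i) / (Real.pi * P.N (n - ℓ + i))) +
          P.γ * (1 / (2 * P.N (n - ℓ + i)) - M₂ * P.δ (n - ℓ + i) / (Real.pi * P.N (n - ℓ + i)))) *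
          (2 * Real.exp (-(M₂ ^ 2 / 2))))) ≤ EV)
    (hEH : (1 + P.γ) * EV + P.γ * (2 * Real.exp (-(M₂ ^ 2 / 2))) * ((1 + P.γ + P.γ ^ 2) ^ n + EV) ≤ EH)
    (hζV : ∀ j, j < n → M₂ * P.δ j / (2 * Real.pi * P.N j) + EV ≤ M₁ * P.δ j / (2 * Real.pi * P.N j))
    (hζH : ∀ j, j < n → M₂ * P.δ j / (2 * Real.pi * P.N j) + EH ≤ M₁ * P.δ j / (2 * Real.pi * P.N j))
    (hB0 : ((P.γ ^ 2 - 3) ^ n)⁻¹ ≤ B 0)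
    (hB : ∀ ℓ, ℓ < n → 4 * B ℓ + 2 * P.N (n - ℓ - 1) * (P.γ + 2 + 2 / P.γ) / (P.γ ^ 2 - 3) ^ (n - ℓ) ≤ B (ℓ + 1))
    (Bad : Set (UnitAddTorus (Fin 2))) (hBadm : MeasurableSet Bad)
    (hBad : ∀ (Y : EuclideanSpace ℝ (Fin 2)) (z : ℝ → ℕ → EuclideanSpace ℝ (Fin 2)),
      (∀ s, z s n = Y + s • EuclideanSpace.single 0 1) →
      (∀ s, ∀ j < n, z s j = shearMapLift 0 1 (amp ⟨P.U j, P.U_periodic j, P.contDiff_U (P.δ_pos hδ₀ hd j)⟩ P.γ)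
        (shearMapLift 1 0 (amp ⟨P.U j, P.U_periodic j, P.contDiff_U (P.δ_pos hδ₀ hd j)⟩ P.γ) (z s (j + 1)))) →
      ∀ s : ℝ, (∃ j', j' < n ∧ ∃ q : ℤ,
        |(z s (j' + 1)) 0 - ((q : ℝ) / 2 + 1 / 4) / P.N j'| < M₁ * P.δ j' / (2 * Real.pi * P.N j') + EV ∨
        |((z s (j' + 1)) 1 - P.γ * P.U j' ((z s (j' + 1)) 0)) - ((q : ℝ) / 2 + 1 / 4) / P.N j'| <
          M₁ * P.δ j' / (2 * Real.pi * P.N j') + EH) →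
        proj (Y + s • EuclideanSpace.single 0 1) ∈ Bad)
    {K : ℕ} (hK : (K : ℝ) < (P.γ ^ 2 - 3) ^ n) (R : Finset (Fin 2 → ℤ)) (hR : ∀ k ∈ R, k 0 ≠ 0 ∧ |k 0| ≤ (K : ℤ)) :
    ∑ k ∈ R, ‖mFourierCoeff (fun x => (a n x : ℂ)) k‖ ^ 2 ≤
      2 * K * ((B n / (Real.pi * (1 - K / (P.γ ^ 2 - 3) ^ n)) + 2 * Real.pi * EV) ^ 2 +
        (2 * (B n / (Real.pi * (1 - K / (P.γ ^ 2 - 3) ^ n)) + 2 * Real.pi * EV) + 1) * (volume Bad).toReal) := by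
  classical
  have hπ := Real.pi_pos
  have hγ0 : 0 < P.γ := by linarith
  have hg3 : 0 < P.γ ^ 2 - 3 := by nlinarith
  have hBn : 0 < B n := B_pos P hγ h8 B hB0 hB n le_rfl
  obtain ⟨hh_meas, hh01, hh_int⟩ := axisAvg_indicator_props hBadm
  set h : UnitAddTorus (Fin 2) → ℝ := axisAvg 0 (Bad.indicator fun _ => (1 : ℝ)) with hh
  have hθ : 0 < 1 - (K : ℝ) / (P.γ ^ 2 - 3) ^ n := by
    rw [sub_pos, div_lt_one (pow_pos hg3 n)]; exact hK
  set CK : ℝ := B n / (Real.pi * (1 - K / (P.γ ^ 2 - 3) ^ n)) + 2 * Real.pi * EV with hCK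
  have hCK0 : 0 ≤ CK := by positivity
  obtain ⟨hg_i, hΓ⟩ := integral_const_add_sq_le hh_meas hh01 hCK0
  rw [hh_int] at hΓ
  -- one horizontal frequency
  have hcol : ∀ m : ℤ, |m| ≤ (K : ℤ) →
      ∑ k ∈ R.filter (fun k => k 0 = m), ‖mFourierCoeff (fun x => (a n x : ℂ)) k‖ ^ 2 ≤
        CK ^ 2 + (2 * CK + 1) * (volume Bad).toReal := by
    intro m hmK
    set c : Fin 2 → ℤ := Pi.single 0 m with hc
    set v : UnitAddTorus (Fin 2) → ℂ := fun x => mFourier (-c) x * (a n x : ℂ) with hv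
    have hvs : IsSmooth v := ContDiff.mul (isSmooth_mFourier (-c)) (Complex.ofRealCLM.contDiff.comp (has n))
    have hAc : Continuous (axisAvg 0 v) := (hvs.axisAvg 0).continuous
    have hP := hasSum_axisBlock hvs.continuous 0 hAc
    have hc0 : ((c 0 : ℤ) : ℝ) = m := by rw [hc, Pi.single_eq_same]
    have hmR : |((c 0 : ℤ) : ℝ)| < (P.γ ^ 2 - 3) ^ n := by
      rw [hc0]; exact lt_of_le_of_lt (by exact_mod_cast hmK) hK
    -- pointwise bound on the line means of `v`
    have hpt : ∀ x, ‖axisAvg 0 v x‖ ≤ CK + h x := by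
      intro x
      obtain ⟨Y, rfl⟩ := proj_surjective x
      obtain ⟨z, hzn, hz⟩ := exists_traj P hδ₀ hd n Y
      have hnorm : ∀ y : UnitAddTorus (Fin 2), ‖mFourier (-c) y‖ = 1 := fun y => by
        simp only [mFourier, ContinuousMap.coe_mk, norm_prod]
        exact Finset.prod_eq_one fun i _ => by simp
      rw [hv, axisAvg_char_mul_eq P hδ₀ hd a b h0 hb hab n c Y z hzn hz, norm_mul, hnorm, one_mul]
      refine (chord_sum_le_axisAvg_lt P hγ h8 hδ₀ hd hN₀ hρ hM₁ hM hMδ B hEV0 hEV hEH hζV hζH hB0 hB Bad hBadm hBad Y z hzn hz hmR).trans ?_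
      have h2 : B n / (Real.pi * (1 - |((c 0 : ℤ) : ℝ)| / (P.γ ^ 2 - 3) ^ n)) ≤
          B n / (Real.pi * (1 - K / (P.γ ^ 2 - 3) ^ n)) := by
        refine div_le_div_of_nonneg_left hBn.le (by positivity) (mul_le_mul_of_nonneg_left ?_ hπ.le)
        have h3 : |((c 0 : ℤ) : ℝ)| ≤ K := by rw [hc0]; exact_mod_cast hmK
        have := div_le_div_of_nonneg_right h3 (pow_pos hg3 n).le
        linarith
      rw [hCK]
      linarith
    -- the column energy of `v`
    have hcolv : ∫ x, ‖axisAvg 0 v x‖ ^ 2 ≤ CK ^ 2 + (2 * CK + 1) * (volume Bad).toReal := by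
      refine le_trans (integral_mono ?_ hg_i fun x => ?_) hΓ
      · exact ((hAc.norm.pow 2).integrable_of_hasCompactSupport (HasCompactSupport.of_compactSpace _))
      · exact pow_le_pow_left₀ (norm_nonneg _) (hpt x) 2
    -- the fibre of `R` over `m`, shifted into the column of `v`
    have hshift : ∀ k ∈ R.filter (fun k => k 0 = m), ‖mFourierCoeff (fun x => (a n x : ℂ)) k‖ ^ 2 =
        (if (k - c) 0 = 0 then (1 : ℝ) else 0) * ‖mFourierCoeff v (k - c)‖ ^ 2 := by
      intro k hk
      have hk0 : k 0 = m := (Finset.mem_filter.mp hk).2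
      have h1 : (k - c) 0 = 0 := by rw [Pi.sub_apply, hc, Pi.single_eq_same, hk0, sub_self]
      rw [if_pos h1, one_mul, hv, mFourierCoeff_char_mul, sub_add_cancel]
    rw [Finset.sum_congr rfl hshift]
    have hP' : HasSum (fun k : Fin 2 → ℤ => (if (k - c) 0 = 0 then (1 : ℝ) else 0) * ‖mFourierCoeff v (k - c)‖ ^ 2)
        (∫ x, ‖axisAvg 0 v x‖ ^ 2) := (Equiv.subRight c).hasSum_iff.mpr hP
    exact (sum_le_hasSum _ (fun k _ => mul_nonneg (by split_ifs <;> norm_num) (sq_nonneg _)) hP').trans hcolv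
  -- sum over the horizontal frequencies
  set M : Finset ℤ := (Finset.Icc (-(K : ℤ)) K).erase 0 with hM
  have hmaps : ∀ k ∈ R, k 0 ∈ M := fun k hk => by
    rw [hM, Finset.mem_erase, Finset.mem_Icc]
    exact ⟨(hR k hk).1, abs_le.mp (hR k hk).2⟩
  have hcardM : (M.card : ℝ) = 2 * K := by
    rw [hM, Finset.card_erase_of_mem (by simp), Int.card_Icc]
    have e : ((K : ℤ) + 1 - -(K : ℤ)).toNat = 2 * K + 1 := by omega
    rw [e]; push_cast; ring
  calc ∑ k ∈ R, ‖mFourierCoeff (fun x => (a n x : ℂ)) k‖ ^ 2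
      = ∑ m ∈ M, ∑ k ∈ R.filter (fun k => k 0 = m), ‖mFourierCoeff (fun x => (a n x : ℂ)) k‖ ^ 2 :=
        (Finset.sum_fiberwise_of_maps_to hmaps _).symm
    _ ≤ ∑ m ∈ M, (CK ^ 2 + (2 * CK + 1) * (volume Bad).toReal) :=
        Finset.sum_le_sum fun m hm => hcol m (abs_le.mpr (Finset.mem_Icc.mp (Finset.mem_erase.mp hm).2))
    _ = 2 * K * (CK ^ 2 + (2 * CK + 1) * (volume Bad).toReal) := by rw [Finset.sum_const, nsmul_eq_mul, hcardM]

/-- **The analytic first good piece with symbolic smallness, rest set through modulated columns.**  As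
`…FirstGoodPieceLt.sqrt_lowModes_le_firstGoodPiece_lt`, with the rest set `R ⊆ {0 < |k₀| ≤ K}` (`K < (γ²−3)^n`) and
`Λ = 2K·(C_K² + (2C_K + 1)·V_B)`, `V_B = Σ_{j<n} 4M₃δ_j/π`. [cite: ElgindiLissMattingly2025, §1.2.2, §3.1] [cite: DEIJ2022, (1.2)–(1.3)] -/
theorem sqrt_lowModes_le_firstGoodPiece_cols (hγ : 1 ≤ P.γ) (h8 : 8 ≤ P.γ ^ 2) (hδ₀ : 0 < P.δ₀) (hd : 0 < P.d) (hN₀ : 1 ≤ P.N₀) (hρ : 1 ≤ P.ρN)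
    {M₁ M₂ : ℝ} (hM₁ : 0 < M₁) (hM : 1 ≤ M₂) (hMδ : ∀ j, M₂ * P.δ j < Real.pi / 2) {n : ℕ}
    (a b : ℕ → UnitAddTorus (Fin 2) → ℝ) (has : ∀ j, IsSmooth (a j)) (h0 : a 0 = datum)
    (hb : ∀ j, b j = a j ∘ shearMap 0 1 (amp ⟨P.U j, P.U_periodic j, P.contDiff_U (P.δ_pos hδ₀ hd j)⟩ P.γ))
    (hab : ∀ j, a (j + 1) = b j ∘ shearMap 1 0 (amp ⟨P.U j, P.U_periodic j, P.contDiff_U (P.δ_pos hδ₀ hd j)⟩ P.γ))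
    {EV EH : ℝ} (B : ℕ → ℝ) (hEV0 : 0 ≤ EV)
    (hEV : ∀ ℓ, ℓ ≤ n → (∑ i ∈ Finset.range ℓ, (1 + P.γ + P.γ ^ 2) ^ i *
        ((P.γ ^ 2 * (1 / (2 * P.N (n - ℓ + i)) - M₂ * P.δ (n - ℓ + i) / (Real.pi * P.N (n - ℓ + i))) +
          P.γ * (1 / (2 * P.N (n - ℓ + i)) - M₂ * P.δ (n - ℓ + i) / (Real.pi * P.N (n - ℓ + i)))) *
          (2 * Real.exp (-(M₂ ^ 2 / 2))))) ≤ EV)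
    (hEH : (1 + P.γ) * EV + P.γ * (2 * Real.exp (-(M₂ ^ 2 / 2))) * ((1 + P.γ + P.γ ^ 2) ^ n + EV) ≤ EH)
    (hζV : ∀ j, j < n → M₂ * P.δ j / (2 * Real.pi * P.N j) + EV ≤ M₁ * P.δ j / (2 * Real.pi * P.N j))
    (hζH : ∀ j, j < n → M₂ * P.δ j / (2 * Real.pi * P.N j) + EH ≤ M₁ * P.δ j / (2 * Real.pi * P.N j))
    (hB0 : ((P.γ ^ 2 - 3) ^ n)⁻¹ ≤ B 0)
    (hB : ∀ ℓ, ℓ < n → 4 * B ℓ + 2 * P.N (n - ℓ - 1) * (P.γ + 2 + 2 / P.γ) / (P.γ ^ 2 - 3) ^ (n - ℓ) ≤ B (ℓ + 1))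
    {M₃ : ℝ} (hM₃ : 1 ≤ M₃) (hM₃δ : ∀ j, M₃ * P.δ j < Real.pi / 2)
    (hV3 : ∀ j, j < n → M₁ * P.δ j / (2 * Real.pi * P.N j) + EV ≤ M₃ * P.δ j / (2 * Real.pi * P.N j))
    (hH3 : ∀ j, j < n → M₁ * P.δ j / (2 * Real.pi * P.N j) + EH ≤ M₃ * P.δ j / (2 * Real.pi * P.N j))
    (μ : (Fin 2 → ℤ) → ℝ) (hμ1 : ∀ k, |μ k| ≤ 1) (R : Finset (Fin 2 → ℤ)) (hμ : ∀ k, k 0 ≠ 0 → k ∉ R → μ k = 0)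
    {K : ℕ} (hK : (K : ℝ) < (P.γ ^ 2 - 3) ^ n) (hR : ∀ k ∈ R, k 0 ≠ 0 ∧ |k 0| ≤ (K : ℤ)) {κ₁ : ℝ} :
    ∀ κ ∈ Ioc (0 : ℝ) κ₁, ∀ w : ℝ → UnitAddTorus (Fin 2) → ℝ,
      FluidPDE.Torus.IsClassicalScalarTransportOn (Ico 0 1) κ P.field w → w 0 = datum →
        Real.sqrt (∑' k, μ k ^ 2 * ‖mFourierCoeff (fun x => (w (tStart n) x : ℂ)) k‖ ^ 2) ≤
          Real.sqrt (((B n / Real.pi + 2 * Real.pi * EV) ^ 2 +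
              (2 * (B n / Real.pi + 2 * Real.pi * EV) + 1) * ∑ j ∈ Finset.range n, 4 * M₃ * P.δ j / Real.pi) +
            2 * K * ((B n / (Real.pi * (1 - K / (P.γ ^ 2 - 3) ^ n)) + 2 * Real.pi * EV) ^ 2 +
              (2 * (B n / (Real.pi * (1 - K / (P.γ ^ 2 - 3) ^ n)) + 2 * Real.pi * EV) + 1) *
                ∑ j ∈ Finset.range n, 4 * M₃ * P.δ j / Real.pi)) +
          Real.sqrt (2 * Real.pi * Real.sqrt (1 + (1 + P.γ) ^ 2) * (1 + P.γ) ^ (2 * n) *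
            Real.sqrt (2 * κ₁ * tStart n * FluidPDE.Torus.scalarL2Sq datum)) := by
  classical
  have hπ := Real.pi_pos
  have hγ0 : 0 < P.γ := by linarith
  have hg3 : 0 < P.γ ^ 2 - 3 := by nlinarith
  have hBn : 0 < B n := B_pos P hγ h8 B hB0 hB n le_rfl
  obtain ⟨Bad, hBadm, hBadvol, hBad⟩ := exists_badSet_lt P hδ₀ hd hN₀ hρ (EV := EV) (EH := EH) hM₃ hM₃δ hV3 hH3
  set VB : ℝ := ∑ j ∈ Finset.range n, 4 * M₃ * P.δ j / Real.pi with hVB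
  have hVBge : (volume Bad).toReal ≤ VB := by
    have hterm : ∀ j, 0 ≤ 4 * M₃ * P.δ j / Real.pi := fun j => by
      have := P.δ_pos hδ₀ hd j
      positivity
    have h1 : volume Bad ≤ ENNReal.ofReal VB := by
      refine hBadvol.trans (le_of_eq ?_)
      rw [hVB, ENNReal.ofReal_sum_of_nonneg fun j _ => hterm j]
      refine Finset.sum_congr rfl fun j _ => ?_
      rw [← ENNReal.ofReal_ofNat 2, ← ENNReal.ofReal_mul (by norm_num)]
      congr 1
      ring
    exact ENNReal.toReal_le_of_le_ofReal (Finset.sum_nonneg fun j _ => hterm j) h1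
  obtain ⟨hh_meas, hh01, hh_int⟩ := axisAvg_indicator_props hBadm
  set h : UnitAddTorus (Fin 2) → ℝ := axisAvg 0 (Bad.indicator fun _ => (1 : ℝ)) with hh
  set C₀ : ℝ := B n / Real.pi + 2 * Real.pi * EV with hC₀
  have hC₀0 : 0 ≤ C₀ := by positivity
  have hle : ∀ x, |axisAvg 0 (a n) x| ≤ C₀ + h x := fun x =>
    abs_axisAvg_iterate_le_lt P hγ h8 hδ₀ hd hN₀ hρ hM₁ hM hMδ a b h0 hb hab B hEV0 hEV hEH hζV hζH hB0 hB Bad hBadm hBad x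
  obtain ⟨hg_i, hΓ'⟩ := integral_const_add_sq_le hh_meas hh01 hC₀0
  rw [hh_int] at hΓ'
  have hΓ : ∫ x, (C₀ + h x) ^ 2 ≤ C₀ ^ 2 + (2 * C₀ + 1) * VB := hΓ'.trans (by gcongr)
  -- the rest set
  set CK : ℝ := B n / (Real.pi * (1 - K / (P.γ ^ 2 - 3) ^ n)) + 2 * Real.pi * EV with hCK
  have hθ : 0 < 1 - (K : ℝ) / (P.γ ^ 2 - 3) ^ n := by
    rw [sub_pos, div_lt_one (pow_pos hg3 n)]; exact hK
  have hCK0 : 0 ≤ CK := by positivity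
  have hrest := restEnergy_le_lt P hγ h8 hδ₀ hd hN₀ hρ hM₁ hM hMδ a b has h0 hb hab B hEV0 hEV hEH hζV hζH hB0 hB Bad hBadm hBad hK R hR
  have hΛ : ∑' k : Fin 2 → ℤ, (if k ∈ (R : Set (Fin 2 → ℤ)) then (1 : ℝ) else 0) *
      ‖mFourierCoeff (fun x => (a n x : ℂ)) k‖ ^ 2 ≤ 2 * K * (CK ^ 2 + (2 * CK + 1) * VB) := by
    have hsum : ∑' k : Fin 2 → ℤ, (if k ∈ (R : Set (Fin 2 → ℤ)) then (1 : ℝ) else 0) *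
        ‖mFourierCoeff (fun x => (a n x : ℂ)) k‖ ^ 2 = ∑ k ∈ R, ‖mFourierCoeff (fun x => (a n x : ℂ)) k‖ ^ 2 := by
      rw [tsum_eq_sum (s := R) (fun k hk => by simp [hk])]
      exact Finset.sum_congr rfl fun k hk => by simp [hk]
    rw [hsum]
    refine hrest.trans ?_
    have hK0 : (0 : ℝ) ≤ 2 * K := by positivity
    exact mul_le_mul_of_nonneg_left (by gcongr) hK0
  -- assemble
  have hres := sqrt_tsum_symbol_sq_datum_le_of_lineMean P hγ0.le hδ₀ hd a b has h0 hb hab n μ hμ1 (R : Set (Fin 2 → ℤ))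
    (fun k hk0 hkR => hμ k hk0 (by exact_mod_cast hkR)) hg_i hle hΓ hΛ (κ₁ := κ₁)
  simpa only [hC₀, hCK, hVB] using hres

end Cascade

end Summit.AnomalousDissipation.AnomalousDissipation.Theorems.SawtoothPulseCascade.K1Start
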